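import Summits.CriticalPhenomena.PercolationContinuityZ3.Theorems.PercNearOneGluingNoHeavyLowerTailAntitheticOneSidedCubes
import HarnessLib

/-!
# `NoHeavyLowerTail` (stmt-CriticalPhenomena-4575) — antithetic cluster pairs: the ADAPTER from super-odd (𝒮) hypotheses to shifted-BIC
# (𝒮_shift) hypotheses — the glue that feeds every 𝒮-input into the re-based handle machinery (prim-hp-2 gen 65, HOME/MEMO-gen65.md §2(d))

Support file (`--supports stmt-CriticalPhenomena-4575`, hull-port prover `prim-hp-2`, gen 65).  No definitions, no named facts, no sorries;
standard axioms.  `𝒮` = twisted-monotone super-odd `K : Set V → Set V → ℝ`; `𝒮_shift = {F⁺(X) − F⁻(Y) : F⁻ ≤ F⁺ monotone} ⊂ 𝒮`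
(`F⁺(A) − F⁻(B)` is twisted-monotone, and `F⁺(A) − F⁻(B) + F⁺(B) − F⁻(A) ≥ 0`).  Hence every positivity statement quantified over 𝒮 —
box partitions (`Box.boxes_sum_nonneg`), checked pair-cube certificates (…AntitheticVectorCert + …Transport), the comparability principle,
the apex lemmas — yields the corresponding statement quantified over 𝒮_shift, which is what the re-based handle machinery
(…AntitheticHandlePrincipleShift, …AntitheticHandleDualShift) consumes.  So the 𝒮_shift dual handle theorem SUPERSEDES the 𝒮 one: same
conclusion from weaker hypotheses, and every old input still feeds it through this adapter.
* `Antithetic.shift_of_superodd_sum` — for any finite family of pairs `(P j, Q j)` (any `Finset` of indices): positivity for all 𝒮-pairs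
  ⇒ positivity for all 𝒮_shift-pairs.  USE: `Pendant.handle_vertex_sum_nonneg_of_oplus_shift … (shift_of_superodd_sum _ _ _ hoplus) …
  (shift_of_superodd_sum _ _ _ hmixed) …` turns the OLD hypotheses (⊕), (M) over 𝒮 into the inputs of the 𝒮_shift dual handle theorem
  (…AntitheticHandleDualShift) — checked (it elaborates; not landed as a separate declaration because its conclusion coincides with the
  𝒮_shift theorem's).
[cite: VandenbergHaggstromKahn2005, §1 p. 6 ("Harris' inequality")]
-/

noncomputable section

namespace Summit.CriticalPhenomena.PercolationContinuityZ3.Theorems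

open scoped Classical

namespace Antithetic

variable {V : Type*}

/-- **𝒮 ⇒ 𝒮_shift adapter.**  If `Σ_{j : p j} K₁(P j, Q j)·K₂(P j, Q j) ≥ 0` for all twisted-monotone super-odd `K₁, K₂`, then
`Σ_{j : p j} (F⁺(P j) − F⁻(Q j))·(G⁺(P j) − G⁻(Q j)) ≥ 0` for all monotone `F⁻ ≤ F⁺`, `G⁻ ≤ G⁺`. [this work] -/
theorem shift_of_superodd_sum {J : Type*} (S : Finset J) (P Q : J → Set V)
    (hplus : ∀ K₁ K₂ : Set V → Set V → ℝ,
      (∀ ⦃A A' B B' : Set V⦄, A ⊆ A' → B' ⊆ B → K₁ A B ≤ K₁ A' B') → (∀ A B, 0 ≤ K₁ A B + K₁ B A) →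
      (∀ ⦃A A' B B' : Set V⦄, A ⊆ A' → B' ⊆ B → K₂ A B ≤ K₂ A' B') → (∀ A B, 0 ≤ K₂ A B + K₂ B A) →
      0 ≤ ∑ j ∈ S, K₁ (P j) (Q j) * K₂ (P j) (Q j))
    (Fp Fm Gp Gm : Set V → ℝ) (hFp : Monotone Fp) (hFm : Monotone Fm) (hF : ∀ A, Fm A ≤ Fp A)
    (hGp : Monotone Gp) (hGm : Monotone Gm) (hG : ∀ A, Gm A ≤ Gp A) :
    0 ≤ ∑ j ∈ S, (Fp (P j) - Fm (Q j)) * (Gp (P j) - Gm (Q j)) := by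
  refine hplus (fun A B => Fp A - Fm B) (fun A B => Gp A - Gm B) ?_ ?_ ?_ ?_
  · exact fun A A' B B' hA hB => sub_le_sub (hFp hA) (hFm hB)
  · intro A B
    have h1 := hF A
    have h2 := hF B
    show 0 ≤ (Fp A - Fm B) + (Fp B - Fm A)
    linarith
  · exact fun A A' B B' hA hB => sub_le_sub (hGp hA) (hGm hB)
  · intro A B
    have h1 := hG A
    have h2 := hG B
    show 0 ≤ (Gp A - Gm B) + (Gp B - Gm A)
    linarith


end Antithetic

end Summit.CriticalPhenomena.PercolationContinuityZ3.Theorems
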